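import Literature.Analysis.UnboundedOperators.UnitaryGroupGenerator
import Mathlib.MeasureTheory.Integral.IntervalIntegral.Basic
import Mathlib.Analysis.InnerProductSpace.Continuous
import HarnessLib

/-!
# The virial theorem of Mourre theory for UNBOUNDED first commutators, integrated (group) form

Topic `Literature/Analysis/UnboundedOperators` (next to `VirialTheorem.lean`, which proves the
`C¹(A; H)` / bounded-commutator form, ABG Prop. 7.2.10, and lists the unbounded variants —
Mourre 1981 Prop. II.4, ABG Prop. 7.5.1, Georgescu–Gérard–Møller 2004, Fröhlich–Merkli 2004 §3 —
under "What is NOT here"). Wanted by route `MourreKoopmanCharges` of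
`AtomisticToContinuum/HydrodynamicLimit` (informal crux `CollisionCommutatorRegularityR`,
stmt-13984, consequence (a): "virial theorem for unbounded positive commutators ⇒ every eigenvector
of `L` … lies in `𝒟`", typed deliverable stmt-14142 `ConservedVectorsOneBody`).

## The statement, and why this form

Everything is phrased through two strongly continuous one-parameter unitary groups on a complex
Hilbert space, `U(t) = e^{itH}` (Hamiltonian `H = U.hamiltonian`, the tree's Stone generator) and
`W(s) = e^{isA}` (the conjugate operator enters only through its group), as in
`ConjugateOperatorRegularity.lean`. Mourre's hypotheses (b) "`e^{isA}` leaves `D(H)` invariant with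
`sup_{|s|≤1} ‖H e^{isA} φ‖ < ∞`" and (c) "`i[H, A]` extends from `D(A) ∩ D(H)` to an `H`-bounded
operator `B`" (Mourre 1981 §I (b)–(c); ABG: `H ∈ C¹(A)` with `[H, iA] ∈ B(D(H), H)`) are used in
the proof of his virial theorem (Prop. II.4) only through the INTEGRATED COMMUTATOR IDENTITY

  `H e^{isA} φ = e^{isA} H φ + ∫₀^s e^{i(s-u)A} B e^{iuA} φ du`,  `φ ∈ D(H)`,

(differentiate `s ↦ e^{-isA} H e^{isA} φ`), and the `(A, N)`-regular variants (Møller–Skibsted 2004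
§2, Georgescu–Gérard–Møller 2004, Fröhlich–Merkli 2004 Thm 3.2: "`H`-bounded" replaced by
"`N`-bounded" for a reference operator `N ≥ 1`) use the same identity on the smaller regular
domain `D(H) ∩ D(N)`. We therefore take the identity itself, on an abstract `W`-invariant regular
domain `S ⊆ D(H)` and for an abstract (everywhere-defined, junk off the relevant vectors) map
`B : H → H`, as the hypothesis `HasIntegratedCommutatorOn U W S B`, and PROVE:

* `HasIntegratedCommutatorOn.inner_comm_eq_zero_of_eigenvector` — **the virial theorem**: for
  every eigenvector `ψ ∈ S` of `H` (`H ψ = c ψ`, `c` real), `⟪ψ, B ψ⟫ = 0`. Proof (Mourre's): by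
  symmetry of `H`, `⟪H ψ, W(s)ψ⟫ = ⟪ψ, H W(s) ψ⟫`, so the identity gives
  `∫₀^s ⟪W(u-s) ψ, B W(u) ψ⟫ du = 0` for every `s`; the integrand is jointly continuous in
  `(s, u)`, hence its value `⟪ψ, B ψ⟫` at `(0, 0)` vanishes (`eq_zero_of_integral_eq_zero`).
* `…_of_mem_invariantVectors` — the frequency-`0` case used by Koopman / return-to-equilibrium
  arguments: `⟪ψ, B ψ⟫ = 0` for every `U`-invariant `ψ ∈ S`.
* `HasIntegratedCommutatorOn.of_hasDerivAt` — the differential form (Mourre's route: `s ↦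
  e^{-isA} H e^{isA} φ` has derivative `e^{-isA} B e^{isA} φ` on regular vectors) implies the
  integrated form (fundamental theorem of calculus);
* sanity: a bounded operator commuting with the group preserves `D(H)` and commutes with `H`
  (`hamiltonian_apply_commute`), so `W := U` (or any group commuting with `U`) satisfies the
  hypothesis with `B = 0` on `S = D(H)` (`HasIntegratedCommutatorOn.of_commute`): the predicate is
  not vacuous.

What the `(A, N)` literature adds and this file does NOT: that eigenvectors lie in the regular
domain (`ψ ∈ D(N^{1/2})`, Fröhlich–Merkli 2004 Thm 3.4 "regularity of eigenfunctions", from a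
lower bound `B ≥ 𝒫 - C`; Georgescu–Gérard–Møller 2004): here `ψ ∈ S` is a HYPOTHESIS of the
virial theorem — exactly the clause a user of consequence (a) of stmt-13984 must supply.

## References

* E. Mourre, *Absence of singular continuous spectrum for certain self-adjoint operators*,
  Comm. Math. Phys. 78 (1981) 391–408, §I conditions (b)–(c), Prop. II.4 (virial theorem).
* W. O. Amrein, A. Boutet de Monvel, V. Georgescu, *C₀-Groups, Commutator Methods and Spectral
  Theory of N-Body Hamiltonians* (1996), Prop. 7.2.10, Prop. 7.5.1.
* J. Fröhlich, M. Merkli, *Thermal ionization*, Math. Phys. Anal. Geom. 7 (2004) 239–287, §3.1,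
  Thm 3.2 (virial theorem with GJN-type `N`-bounds), Thm 3.4.
* V. Georgescu, C. Gérard, J. S. Møller, *Spectral theory of massless Pauli–Fierz models*,
  Comm. Math. Phys. 249 (2004) 29–78.
-/

noncomputable section

open Filter Set MeasureTheory intervalIntegral
open scoped InnerProductSpace Topology

namespace Literature.Analysis.UnboundedOperators

namespace UnitaryRep

variable {H : Type*} [NormedAddCommGroup H] [InnerProductSpace ℂ H] [CompleteSpace H]

/-! ## An averaging lemma -/

/-- If `F : ℝ × ℝ → E` is continuous and `∫₀^s F(s, u) du = 0` for all small `s > 0`, then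
`F(0, 0) = 0` (the averages `s⁻¹ ∫₀^s F(s, u) du` tend to `F(0, 0)`). [folklore] -/
theorem eq_zero_of_integral_eq_zero {E : Type*} [NormedAddCommGroup E] [NormedSpace ℝ E]
    [CompleteSpace E] {F : ℝ × ℝ → E} (hF : Continuous F)
    (hint : ∀ᶠ s in 𝓝[>] (0 : ℝ), ∫ u in (0 : ℝ)..s, F (s, u) = 0) : F (0, 0) = 0 := by
  by_contra hne
  have hpos : 0 < ‖F (0, 0)‖ := norm_pos_iff.2 hne
  -- continuity at `(0, 0)`: `‖F p - F (0,0)‖ < ‖F (0,0)‖ / 2` on a ball of radius `δ`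
  have hc : ContinuousAt F (0, 0) := hF.continuousAt
  rw [Metric.continuousAt_iff] at hc
  obtain ⟨δ, hδ, hball⟩ := hc (‖F (0, 0)‖ / 2) (by positivity)
  -- a small `s` with vanishing integral
  have hsmall : ∀ᶠ s in 𝓝[>] (0 : ℝ), s < δ := by
    have : Set.Iio δ ∈ 𝓝 (0 : ℝ) := Iio_mem_nhds hδ
    exact mem_nhdsWithin_of_mem_nhds this
  obtain ⟨s, ⟨hs0, hsδ⟩, hspos⟩ := ((hint.and hsmall).and self_mem_nhdsWithin).exists
  change 0 < s at hspos
  -- on `[0, s]` the integrand is within `‖F(0,0)‖/2` of `F(0,0)`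
  have hbound : ∀ u ∈ Set.uIoc (0 : ℝ) s, ‖F (s, u) - F (0, 0)‖ ≤ ‖F (0, 0)‖ / 2 := by
    intro u hu
    rw [Set.uIoc_of_le hspos.le] at hu
    have hsu : dist (s, u) ((0 : ℝ), (0 : ℝ)) < δ := by
      rw [Prod.dist_eq, Real.dist_eq, Real.dist_eq, sub_zero, sub_zero, max_lt_iff]
      exact ⟨by rwa [abs_of_pos hspos], by rw [abs_of_pos hu.1]; exact lt_of_le_of_lt hu.2 hsδ⟩
    have hd := hball hsu
    rw [dist_eq_norm] at hd
    exact hd.le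
  have hFi : IntervalIntegrable (fun u => F (s, u)) volume 0 s :=
    ((hF.comp (Continuous.prodMk continuous_const continuous_id)).intervalIntegrable 0 s)
  have h1 : ∫ u in (0 : ℝ)..s, (F (s, u) - F (0, 0)) = -(s • F (0, 0)) := by
    rw [intervalIntegral.integral_sub hFi (intervalIntegrable_const), hs0,
      intervalIntegral.integral_const, sub_zero, zero_sub]
  have h2 : ‖∫ u in (0 : ℝ)..s, (F (s, u) - F (0, 0))‖ ≤ ‖F (0, 0)‖ / 2 * |s - 0| :=
    intervalIntegral.norm_integral_le_of_norm_le_const hbound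
  rw [h1, norm_neg, norm_smul, Real.norm_eq_abs, sub_zero, abs_of_pos hspos] at h2
  nlinarith

/-! ## Joint continuity of the group action -/

/-- Joint continuity `(t, x) ↦ U(t) x` of a strongly continuous one-parameter unitary group
(isometries: `‖U(t)x - U(t₀)x₀‖ ≤ ‖x - x₀‖ + ‖U(t)x₀ - U(t₀)x₀‖`). [folklore] -/
theorem continuous_appReal_uncurry (U : OneParameterUnitaryGroup H) :
    Continuous fun p : ℝ × H => U.appReal p.1 p.2 := by
  rw [continuous_iff_continuousAt]
  rintro ⟨t₀, x₀⟩
  rw [ContinuousAt, tendsto_iff_norm_sub_tendsto_zero]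
  have ha : Tendsto (fun p : ℝ × H => ‖p.2 - x₀‖) (𝓝 (t₀, x₀)) (𝓝 0) := by
    have hc : Continuous fun p : ℝ × H => ‖p.2 - x₀‖ := by fun_prop
    simpa using hc.tendsto (t₀, x₀)
  have hb : Tendsto (fun p : ℝ × H => ‖U.appReal p.1 x₀ - U.appReal t₀ x₀‖) (𝓝 (t₀, x₀))
      (𝓝 0) := by
    have hc : Continuous fun p : ℝ × H => ‖U.appReal p.1 x₀ - U.appReal t₀ x₀‖ :=
      (((U.continuous_appReal_apply x₀).comp continuous_fst).sub continuous_const).norm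
    simpa using hc.tendsto (t₀, x₀)
  refine squeeze_zero (fun p => norm_nonneg _) (fun p => ?_) (by simpa using ha.add hb)
  calc ‖U.appReal p.1 p.2 - U.appReal t₀ x₀‖
      = ‖U.appReal p.1 (p.2 - x₀) + (U.appReal p.1 x₀ - U.appReal t₀ x₀)‖ := by
        congr 1; simp only [map_sub]; abel
    _ ≤ ‖U.appReal p.1 (p.2 - x₀)‖ + ‖U.appReal p.1 x₀ - U.appReal t₀ x₀‖ := norm_add_le _ _
    _ = ‖p.2 - x₀‖ + ‖U.appReal p.1 x₀ - U.appReal t₀ x₀‖ := by rw [norm_appReal]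

/-! ## Bounded operators commuting with the group -/

/-- A bounded operator commuting with every `U(t)` maps `D(H)` into itself and commutes with the
Hamiltonian: `H (C x) = C (H x)` (the difference quotients of `C x` are `C` applied to those of
`x`). [folklore] -/
theorem hamiltonian_apply_commute (U : OneParameterUnitaryGroup H) (C : H →L[ℂ] H)
    (hC : ∀ t : ℝ, C * U.appReal t = U.appReal t * C) {x : H} (hx : x ∈ U.hamiltonian.domain) :
    ∃ hCx : C x ∈ U.hamiltonian.domain,
      U.hamiltonian ⟨C x, hCx⟩ = C (U.hamiltonian ⟨x, hx⟩) := by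
  set T := OneParameterGroup.toC0Semigroup U.toStrongContRepresentation with hT
  have hTt : ∀ t : NNReal, T.app t = U.appReal t := fun t => by
    rw [hT, OneParameterGroup.toC0Semigroup_app, app_toStrongContRepresentation]
  have hxT : x ∈ T.generator.domain := hx
  have hlim := C0Semigroup.tendsto_generator T ⟨x, hxT⟩
  -- the difference quotient of `C x` is `C` of the difference quotient of `x`
  have hlimC : Tendsto (fun t : ℝ => ((t⁻¹ : ℝ) : ℂ) • (T.app t.toNNReal (C x) - C x))
      (𝓝[>] 0) (𝓝 (C (T.generator ⟨x, hxT⟩))) := by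
    refine ((C.continuous.tendsto _).comp hlim).congr fun t => ?_
    simp only [Function.comp_apply, map_smul, map_sub, hTt]
    congr 2
    change (C * U.appReal _) x = (U.appReal _ * C) x
    rw [hC]
  have hCxT : C x ∈ T.generator.domain :=
    (C0Semigroup.mem_generator_domain_iff T (C x)).2 ⟨_, hlimC⟩
  have hval : T.generator ⟨C x, hCxT⟩ = C (T.generator ⟨x, hxT⟩) :=
    C0Semigroup.generator_apply_eq_of_tendsto T ⟨C x, hCxT⟩ hlimC
  refine ⟨hCxT, ?_⟩
  rw [hamiltonian_apply, hamiltonian_apply, map_smul]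
  exact congrArg (fun y => (-Complex.I) • y) hval

/-! ## The integrated commutator identity (hypothesis) -/

/-- **First-order regularity of `H` with respect to `A`, integrated form, on a regular domain `S`.**
For the unitary groups `U(t) = e^{itH}` and `W(s) = e^{isA}`, a set `S ⊆ D(H)` and a map
`B : H → H` (the first commutator `i[H, A]`; only its values on `W(u) φ`, `φ ∈ S`, matter):
`S` is invariant under every `W(s)`, `u ↦ B W(u) φ` is continuous, and
`H W(s) φ = W(s) H φ + ∫₀^s W(s-u) B W(u) φ du` for `φ ∈ S` and all `s` — the identity obtained
from Mourre's conditions (b)–(c) by differentiating `s ↦ e^{-isA} H e^{isA} φ` (Mourre 1981 §I,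
proof of Prop. II.4, with `S = D(H)`), resp. from `(A, N)`-regularity with `S = D(H) ∩ D(N)`
(Fröhlich–Merkli 2004 §3.1; Georgescu–Gérard–Møller 2004). [cite: Mourre1981, §I (b)–(c) and Prop. II.4] -/
structure HasIntegratedCommutatorOn (U W : OneParameterUnitaryGroup H) (S : Set H) (B : H → H) :
    Prop where
  /-- the regular domain lies in the domain of the Hamiltonian -/
  subset_domain : S ⊆ U.hamiltonian.domain
  /-- the regular domain is invariant under the conjugate group -/
  appReal_mem : ∀ (s : ℝ) ⦃φ : H⦄, φ ∈ S → W.appReal s φ ∈ S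
  /-- the commutator along the conjugate orbit of a regular vector is continuous -/
  continuous_comm : ∀ ⦃φ : H⦄, φ ∈ S → Continuous fun u : ℝ => B (W.appReal u φ)
  /-- the integrated commutator identity `H W(s) φ = W(s) H φ + ∫₀^s W(s-u) B W(u) φ du` -/
  hamiltonian_appReal : ∀ ⦃φ : H⦄ (hφ : φ ∈ S) (s : ℝ),
    U.hamiltonian ⟨W.appReal s φ, subset_domain (appReal_mem s hφ)⟩ =
      W.appReal s (U.hamiltonian ⟨φ, subset_domain hφ⟩) +
        ∫ u in (0 : ℝ)..s, W.appReal (s - u) (B (W.appReal u φ))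

namespace HasIntegratedCommutatorOn

variable {U W : OneParameterUnitaryGroup H} {S : Set H} {B : H → H}

/-- **Non-vacuity**: if every `W(s)` commutes with every `U(t)`, the identity holds on
`S = D(H)` with `B = 0`. [folklore] -/
theorem of_commute (hc : ∀ s t : ℝ, W.appReal s * U.appReal t = U.appReal t * W.appReal s) :
    HasIntegratedCommutatorOn U W (U.hamiltonian.domain : Set H) 0 where
  subset_domain := subset_rfl
  appReal_mem s φ hφ := (U.hamiltonian_apply_commute (W.appReal s) (hc s) hφ).1
  continuous_comm φ _ := continuous_const
  hamiltonian_appReal φ hφ s := by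
    obtain ⟨h1, h2⟩ := U.hamiltonian_apply_commute (W.appReal s) (hc s) hφ
    simp only [Pi.zero_apply, map_zero, intervalIntegral.integral_zero, add_zero]
    exact h2

/-- **The differential form implies the integrated form** (Mourre's route): if `S ⊆ D(H)` is
`W`-invariant, `u ↦ B W(u) φ` is continuous, and `s ↦ W(-s) H W(s) φ` has derivative
`W(-s) B W(s) φ` everywhere (`d/ds e^{-isA} H e^{isA} = e^{-isA} i[H, A] e^{isA}` on regular
vectors), then the integrated commutator identity holds (fundamental theorem of calculus, then
apply `W(s)`). [cite: Mourre1981, §I (b)–(c)] -/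
theorem of_hasDerivAt (hS : S ⊆ U.hamiltonian.domain)
    (hW : ∀ (s : ℝ) ⦃φ : H⦄, φ ∈ S → W.appReal s φ ∈ S)
    (hcont : ∀ ⦃φ : H⦄, φ ∈ S → Continuous fun u : ℝ => B (W.appReal u φ))
    (hderiv : ∀ ⦃φ : H⦄ (hφ : φ ∈ S) (s : ℝ),
      HasDerivAt (fun r : ℝ => W.appReal (-r) (U.hamiltonian ⟨W.appReal r φ, hS (hW r hφ)⟩))
        (W.appReal (-s) (B (W.appReal s φ))) s) :
    HasIntegratedCommutatorOn U W S B where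
  subset_domain := hS
  appReal_mem := hW
  continuous_comm := hcont
  hamiltonian_appReal φ hφ s := by
    -- FTC for `r ↦ W(-r) H W(r) φ` on `[0, s]`
    have hci : Continuous fun u : ℝ => W.appReal (-u) (B (W.appReal u φ)) :=
      W.continuous_appReal_uncurry.comp (continuous_neg.prodMk (hcont hφ))
    have hftc := intervalIntegral.integral_eq_sub_of_hasDerivAt
      (fun r _ => hderiv hφ r) (hci.intervalIntegrable 0 s)
    simp only [neg_zero, appReal_zero, one_apply_eq_self] at hftc
    -- apply `W(s)` to both sides
    have happly := congrArg (W.appReal s) hftc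
    rw [map_sub, appReal_apply_appReal_neg,
      ← ContinuousLinearMap.intervalIntegral_comp_comm (W.appReal s) (hci.intervalIntegrable 0 s)]
      at happly
    rw [eq_sub_iff_add_eq] at happly
    rw [← happly, add_comm]
    congr 1
    refine intervalIntegral.integral_congr fun u _ => ?_
    change (W.appReal s * W.appReal (-u)) (B (W.appReal u φ)) = W.appReal (s - u) (B (W.appReal u φ))
    rw [← appReal_add, sub_eq_add_neg]

/-- Along the conjugate orbit of a regular vector `ψ`, the matrix element
`(s, u) ↦ ⟪W(u - s) ψ, B W(u) ψ⟫` is jointly continuous. [folklore] -/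
theorem continuous_inner_comm (h : HasIntegratedCommutatorOn U W S B) {ψ : H} (hψ : ψ ∈ S) :
    Continuous fun p : ℝ × ℝ => ⟪W.appReal (p.2 - p.1) ψ, B (W.appReal p.2 ψ)⟫_ℂ :=
  ((W.continuous_appReal_apply ψ).comp (continuous_snd.sub continuous_fst)).inner
    ((h.continuous_comm hψ).comp continuous_snd)

/-- For a regular eigenvector `ψ` (`H ψ = c ψ`, `c` real) the integrated commutator has
vanishing expectation: `∫₀^s ⟪W(u-s) ψ, B W(u) ψ⟫ du = 0` for every `s` (symmetry of `H`).
[cite: Mourre1981, proof of Prop. II.4] -/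
theorem integral_inner_comm_eq_zero (h : HasIntegratedCommutatorOn U W S B) {ψ : H} (hψ : ψ ∈ S)
    {c : ℝ} (hc : U.hamiltonian ⟨ψ, h.subset_domain hψ⟩ = (c : ℂ) • ψ) (s : ℝ) :
    ∫ u in (0 : ℝ)..s, ⟪W.appReal (u - s) ψ, B (W.appReal u ψ)⟫_ℂ = 0 := by
  have hid := h.hamiltonian_appReal hψ s
  rw [hc, map_smul] at hid
  -- symmetry of `H` between `ψ` and `W(s) ψ`
  have hsym := U.hamiltonian_isSymmetric ⟨ψ, h.subset_domain hψ⟩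
    ⟨W.appReal s ψ, h.subset_domain (h.appReal_mem s hψ)⟩
  simp only [hc, hid] at hsym
  rw [inner_smul_left, Complex.conj_ofReal, inner_add_right, inner_smul_right, eq_comm,
    add_eq_left] at hsym
  -- move the inner product inside the integral and `W(s-u)` to the left slot
  have hint : IntervalIntegrable (fun u => W.appReal (s - u) (B (W.appReal u ψ))) volume 0 s := by
    refine Continuous.intervalIntegrable ?_ 0 s
    exact W.continuous_appReal_uncurry.comp ((continuous_const.sub continuous_id).prodMk (h.continuous_comm hψ))
  change innerSL ℂ ψ (∫ u in (0 : ℝ)..s, W.appReal (s - u) (B (W.appReal u ψ))) = 0 at hsym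
  rw [← ContinuousLinearMap.intervalIntegral_comp_comm (innerSL ℂ ψ) hint] at hsym
  simp only [innerSL_apply_apply] at hsym
  rw [← hsym]
  refine intervalIntegral.integral_congr fun u _ => ?_
  show ⟪W.appReal (u - s) ψ, B (W.appReal u ψ)⟫_ℂ = ⟪ψ, W.appReal (s - u) (B (W.appReal u ψ))⟫_ℂ
  rw [inner_appReal_left, neg_sub]

/-- **The virial theorem, unbounded-commutator / integrated form** (Mourre 1981 Prop. II.4; the
`(A, N)`-regular versions of Fröhlich–Merkli 2004 Thm 3.2 and Georgescu–Gérard–Møller 2004 on the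
regular domain): if `H` has the integrated first-order commutator `B` with respect to `A` on the
regular domain `S`, then every eigenvector `ψ ∈ S` of `H` satisfies `⟪ψ, B ψ⟫ = 0`.
[cite: Mourre1981, Prop. II.4] -/
theorem inner_comm_eq_zero_of_eigenvector (h : HasIntegratedCommutatorOn U W S B) {ψ : H}
    (hψ : ψ ∈ S) {c : ℝ} (hc : U.hamiltonian ⟨ψ, h.subset_domain hψ⟩ = (c : ℂ) • ψ) :
    ⟪ψ, B ψ⟫_ℂ = 0 := by
  have key := eq_zero_of_integral_eq_zero (h.continuous_inner_comm hψ)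
    (Eventually.of_forall fun s => h.integral_inner_comm_eq_zero hψ hc s)
  simpa using key

/-- **Virial theorem at frequency `0`**: every `U`-invariant regular vector `ψ ∈ S` has
`⟪ψ, B ψ⟫ = 0` (invariant vectors form the kernel of `H`). [cite: Mourre1981, Prop. II.4] -/
theorem inner_comm_eq_zero_of_mem_invariantVectors (h : HasIntegratedCommutatorOn U W S B) {ψ : H}
    (hψ : ψ ∈ S) (hinv : ψ ∈ U.invariantVectors) : ⟪ψ, B ψ⟫_ℂ = 0 := by
  have hker := U.invariantVectors_le_kernel_hamiltonian hinv
  obtain ⟨hdom, hval⟩ := LinearPMap.mem_kernel_iff.mp hker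
  refine h.inner_comm_eq_zero_of_eigenvector hψ (c := 0) ?_
  simpa using hval

end HasIntegratedCommutatorOn

end UnitaryRep

end Literature.Analysis.UnboundedOperators
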